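import Literature.AlgebraicGeometry.Frobenioids.PerfectionLifting
import Literature.AlgebraicGeometry.Frobenioids.PerfectionDivisorial
import Literature.AlgebraicGeometry.Frobenioids.MonoidFunctorsOnD
import Literature.AlgebraicGeometry.Frobenioids.PreFrobenioidDataToFunctor
import Mathlib.CategoryTheory.IsConnected
import HarnessLib

/-!
# Frobenioids I, Proposition 3.2 (iii), "`C^pf` is a Frobenioid": the standing hypotheses of
# Definition 1.1 (iv) / 1.3 for the perfection — `C^pf → F_{Φ^pf}` is a pre-Frobenioid (PROOFS)

Mochizuki, *The geometry of Frobenioids I: the general theory*, Kyushu J. Math. **62** (2008)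
293–400, Definition 1.1 (ii), (iv) pp. 19–20, Definition 3.1 (iii) p. 57, Proposition 3.2 (iii) p. 59
[cite: MochizukiFrdI2008, Prop. 3.2 (iii) p.59]: "`C^pf`, equipped with the functor `C^pf → F_{Φ^pf}` of
(i), is a Frobenioid".  A Frobenioid is in particular a pre-Frobenioid (Def. 1.1 (iv)): its divisor monoid is
a divisorial monoid on the base category, and both the base category and the category itself are connected and
totally epimorphic.  This file is the clause-group `IsFrobenioid.isPreFrobenioid` of the verification that
THE perfection `Perfection hF` of a Frobenioid (seat abc-iut-L1-d9: `Perfection.lean`, `PerfectionCategory.lean`,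
`PerfectionOps.lean`), with its structure functor `(Perfection.ops hF).toFunctor : C^pf ⥤ F_{Φ^pf}`
(`PreFrobenioidDataToFunctor.lean`, seat abc-iut-L1-d1), is a Frobenioid (abc-iut cell, row
`FrdI:Prop3.2(iii)-frobenioid`; assembly `PerfectionIsFrobenioid.lean`):

* `monFunctor_ops` — the divisor monoid of `C^pf → F_{Φ^pf}` IS `Φ^pf = perfectionFunctor Φ` (`rfl`);
* `isMonoidOn_perfectionFunctor` — for a divisorial monoid `Φ` on `D`, `Φ^pf` is a monoid on `D`
  (Def. 1.1 (ii): pull-backs injective — `perfectionMap_injective`, seat abc-iut-L1-t2 — and injective on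
  characteristics because the `Φ(X)^pf` are sharp; bijective along FSM-morphisms), and divisorial
  (`IsDivisorial.perfection`, seat abc-iut-L1-d1);
* `isGraphConnected_perfection` — `C^pf` is connected: `(A, n) → (A, 1) = ι(A)` is the `n`-th power map and
  `ι : C → C^pf` carries the zigzags of the connected category `C`;
* `isTotallyEpimorphic_perfection` — every arrow of `C^pf` is an epimorphism (`epi_hom`, seat abc-iut-L1-d1);
* `isPreFrobenioid_perfection` — the conjunction, `IsPreFrobenioid Φ^pf (Perfection.ops hF).toFunctor`.

No Frobenius-isotropic hypothesis is needed here.  No new definitions; nothing is specific to the abc programme.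
-/

namespace Literature.AlgebraicGeometry.Frobenioids

open CategoryTheory Opposite Function

universe w v v' u u'

/-! ### §0: an injective homomorphism into a sharp monoid is characteristically injective -/

/-- An injective homomorphism of commutative monoids whose target is sharp is characteristically injective:
associated images are equal images (§0 p. 11, Def. 1.1 (ii)(a)). [cite: MochizukiFrdI2008, Def. 1.1 (ii) p.19] -/
theorem isCharInjective_of_injective_of_isSharp_target {M N : Type w} [CommMonoid M] [CommMonoid N]
    (φ : M →* N) (hφ : Injective φ) (hN : IsSharp N) : IsCharInjective φ := by
  refine ⟨hφ, fun x y hxy => ?_⟩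
  obtain ⟨a, rfl⟩ := Associates.mk_surjective x
  obtain ⟨b, rfl⟩ := Associates.mk_surjective y
  rw [associatesMap_mk, associatesMap_mk, Associates.mk_eq_mk_iff_associated] at hxy
  obtain ⟨u, hu⟩ := hxy
  have hu1 : (u : N) = 1 := hN.1 _ u.isUnit
  rw [hu1, mul_one] at hu
  rw [hφ hu]

/-! ### Definition 1.1 (ii): `Φ^pf` is a divisorial monoid on `D` -/

section OnD

variable {D : Type u} [Category.{v} D] {Φ : Dᵒᵖ ⥤ CommMonCat.{w}}

/-- **Def. 1.1 (ii) for `Φ^pf`**: if `Φ` is a monoid on `D` with sharp values (e.g. divisorial), then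
`Φ^pf = perfectionFunctor Φ` is a monoid on `D` — pull-backs are characteristically injective (injective by
functoriality of `M ↦ M^pf` on injections; injective on characteristics since the `Φ(X)^pf` are sharp) and
bijective along FSM-morphisms. [cite: MochizukiFrdI2008, Def. 1.1 (ii) p.19] -/
theorem isMonoidOn_perfectionFunctor (hΦ : IsMonoidOn Φ) (hsharp : Objectwise (fun M _ => IsSharp M) Φ) :
    IsMonoidOn (perfectionFunctor Φ) where
  isCharInjective f :=
    isCharInjective_of_injective_of_isSharp_target _ (perfectionFunctor_pull_injective_and_bijective Φ hΦ f).1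
      (Perfection.isSharp (hsharp _))
  bijective_of_isFSM f hf := (perfectionFunctor_pull_injective_and_bijective Φ hΦ f).2 hf

/-- `Φ^pf` is divisorial if `Φ` is (objectwise `IsDivisorial.perfection`). [cite: MochizukiFrdI2008, Def. 1.1 (ii) p.19] -/
theorem isDivisorial_perfectionFunctor (hΦ : Objectwise (fun M _ => IsDivisorial M) Φ) :
    Objectwise (fun M _ => IsDivisorial M) (perfectionFunctor Φ) :=
  fun X => IsDivisorial.perfection (hΦ X)

end OnD

namespace PreFrobenioid

namespace Perfection

variable {D : Type u} [Category.{v} D] {Φ : Dᵒᵖ ⥤ CommMonCat.{w}}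
  {C : Type u'} [Category.{v'} C] {F : C ⥤ ElemFrobenioid Φ} {hF : IsFrobenioid F}

/-! ### The divisor monoid of `C^pf → F_{Φ^pf}` is `Φ^pf` -/

variable (hF) in
/-- The divisor monoid of the structure functor `(Perfection.ops hF).toFunctor : C^pf → F_{Φ^pf}` is
`Φ^pf = perfectionFunctor Φ`, on the nose. [cite: MochizukiFrdI2008, Prop. 3.2 (i) p.58] -/
theorem monFunctor_ops : (ops hF).monFunctor = perfectionFunctor Φ := rfl

variable (hF) in
/-- The base functor of `C^pf → F_{Φ^pf}` is `Base : C^pf → D` of `Perfection.ops`.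
[cite: MochizukiFrdI2008, Prop. 3.2 (i) p.58] -/
theorem baseFunctor_toFunctor_ops : PreFrobenioid.baseFunctor (ops hF).toFunctor = (ops hF).base := rfl

/-! ### `C^pf` is connected and totally epimorphic -/

/-- The `n`-th power map `(A, n) → (A, 1) = ι(A)`: the class at level `(1, n)` of the transition
`A^{(1)} → A^{(n)}`. [cite: MochizukiFrdI2008, Def. 3.1 (iii) p.57] -/
theorem nonempty_hom_toPf_obj (X : Perfection hF) : Nonempty (X ⟶ (toPf hF).obj X.obj) :=
  ⟨Hom.mk (⟨⟨1, X.idx, by rw [mul_one]; exact (one_mul _).symm⟩, frobTrans hF X.obj (one_dvd X.idx)⟩ :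
    Rep X (root hF X.obj 1))⟩

variable (hF) in
/-- **`C^pf` is connected** (Def. 1.1 (iv) for the perfection): any two objects `(A, n)`, `(B, m)` are joined by
the zigzag `(A, n) → ι(A) ~ ι(B) ← (B, m)`, the middle part being the image under `ι : C → C^pf` of a zigzag of
the connected category `C`. [cite: MochizukiFrdI2008, Prop. 3.2 (iii) p.59] -/
theorem isGraphConnected_perfection : IsGraphConnected (Perfection hF) := by
  have hC := hF.isPreFrobenioid.isGraphConnected
  obtain ⟨A₀⟩ := hC.nonempty
  refine ⟨⟨root hF A₀ 1⟩, fun X Y => ?_⟩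
  obtain ⟨f⟩ := nonempty_hom_toPf_obj X
  obtain ⟨g⟩ := nonempty_hom_toPf_obj Y
  exact ((Zigzag.of_hom f).trans (zigzag_obj_of_zigzag (toPf hF) (hC.zigzag X.obj Y.obj))).trans
    (Zigzag.of_inv g)

variable (hF) in
/-- **`C^pf` is totally epimorphic** (Def. 1.1 (iv) for the perfection; `epi_hom`).
[cite: MochizukiFrdI2008, Prop. 3.2 (iii) p.59] -/
theorem isTotallyEpimorphic_perfection : IsTotallyEpimorphic (Perfection hF) := ⟨fun f => epi_hom f⟩

/-! ### Definition 1.1 (iv) for `C^pf → F_{Φ^pf}` -/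

variable (hF) in
/-- **`C^pf → F_{Φ^pf}` is a pre-Frobenioid** (the field `isPreFrobenioid` of "`C^pf` is a Frobenioid",
Prop. 3.2 (iii)): `Φ^pf` is a divisorial monoid on the connected, totally epimorphic base `D`, and `C^pf` is
connected and totally epimorphic. [cite: MochizukiFrdI2008, Prop. 3.2 (iii) p.59] -/
theorem isPreFrobenioid_perfection : IsPreFrobenioid (ops hF).monFunctor (ops hF).toFunctor where
  isMonoidOn := isMonoidOn_perfectionFunctor hF.isPreFrobenioid.isMonoidOn
    fun X => (hF.isPreFrobenioid.isDivisorial X).isSharp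
  isDivisorial := isDivisorial_perfectionFunctor hF.isPreFrobenioid.isDivisorial
  isGraphConnected_base := hF.isPreFrobenioid.isGraphConnected_base
  isTotallyEpimorphic_base := hF.isPreFrobenioid.isTotallyEpimorphic_base
  isGraphConnected := isGraphConnected_perfection hF
  isTotallyEpimorphic := isTotallyEpimorphic_perfection hF

/-! ### Consequences used by the other clause-groups -/

/-- An isomorphism of `C^pf` is an isometry (its perfected divisor is trivial; `Φ^pf` is sharp).
[cite: MochizukiFrdI2008, Rem. 1.1.1 p.21] -/
theorem isIsometry_of_isIso {X Y : Perfection hF} (e : X ⟶ Y) [IsIso e] : (ops hF).IsIsometry e :=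
  PreFrobenioid.isIsometry_of_isIso (ops hF).toFunctor (isPreFrobenioid_perfection hF) e

/-- An isomorphism of `C^pf` is an arrow of Frobenius type. [cite: MochizukiFrdI2008, Def. 1.2 (iii) p.22] -/
theorem isFrobeniusType_of_isIso {X Y : Perfection hF} (e : X ⟶ Y) [IsIso e] : (ops hF).IsFrobeniusType e :=
  (PreFrobenioidData.isFrobeniusType_toFunctor_iff (ops hF) e).mp
    (PreFrobenioid.isFrobeniusType_of_isIso (ops hF).toFunctor (isPreFrobenioid_perfection hF) e)

end Perfection

end PreFrobenioid

end Literature.AlgebraicGeometry.Frobenioids
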